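import Summits.BirchSwinnertonDyer.Rank1Residual.X2.NonsplitBDPExists
import HarnessLib

/-!
# O9 ∩ {non-split}: `BSD(E,p)` at a Heegner datum FROM PRINT + THE RESIDUAL + THE TWO HALVES OVER
# THE FRAME (cell `bsd-eis`, seat `bsd-eis-cgshw`; TARGET §1.3 ROUTING v1.4 (3)(b1) / v1.8.10 —
# the assembly half of the Hsieh existence glue; definitions live in `X2/NonsplitBDPExists.lean`)

HONEST FRAMING (cell `bsd-eis`): theorems only; nothing booked; X2 stays CONSTRUCTION-SHAPED; no
label moves. With `X2/NonsplitBDPExists.lean` (the `@[conjecture]` residual `HsiehFrameResidualAt W p`,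
the prime-generic glue, `exists_isBDPLFunction_of_hsieh2014_of_not_split`, and the two halves
`NonsplitBDPValueOnTree W p` (H2) / `NonsplitIMCEqOnTree W p` (H3) quantified over the frame):

* **`bsdp_of_cellCNonsplitNotGV_of_hsieh2014_of_halvesOnTree`** (ψ even) — at a Heegner datum of a
  ψ-even non-split X2c pair, `BSD(E,p)` from the PUBLISHED facts of `X2/RankOneChain`, GZK /
  modularity, the five cited cohomological facts of the control theorem, Hsieh 2014 Thm. 1 (PUB), the
  residual (NOT in print), H2 (PUB shape at `p ≥ 5`, open at `p = 3`) and H3 (Keller–Yin Thm. D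
  shape, PREPRINT with the L1754 gap). The frame is PRODUCED: an embedding datum `ι₀ : ℚ̄_p ≃ ℂ`
  exists (Steinitz, `PadicAlgCl.nonempty_ringEquiv_complex`), the degree-one `𝔭` of the datum is
  induced by `ι₀` or `ι₀ ∘ conj` (`X11b.exists_datum_forall_mem_iff`), Hsieh + residual + glue give
  `(Ω_K, Ω_p, L)` there, H2/H3 are instantiated at it, and p403688's
  `X2.bsdp_of_cellCNonsplitNotGV_of_halves` concludes;
* **`bsdp_of_cellC_of_not_split_of_hsieh2014_of_halvesOnTree_of_partner`** (either parity) —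
  p398550's `bsdp_of_cellC_of_not_split_of_imcWaldspurgerOnTree_of_partner` with the composite input
  replaced the same way; the partner's `PPartRankZero Wd p` stays explicit (CLOSED in X2a when ψ is
  even; when ψ is odd it is Mazur's main conjecture at a non-split Eisenstein `p ‖ N` — MEMO-1 K2ᴱ-cyc
  / MEMO-2 R9 via p396260 / p396524);
* **`bsdp_of_cellC_of_not_split_of_hsieh2014_of_halvesOnTree_of_mazurMainConjectureAt`** (append,
  g2) — the same with the partner's input in main-conjecture form: `X2.MazurMainConjectureAt Wd p`
  (Mazur's MC at the non-split Eisenstein `p ‖ N` for the twist; MEMO-4 §B's R9 target) ⟹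
  `PPartRankZero Wd p` via `X2/RankZero.lean`'s published rank-zero closer.

So on ALL of O9 ∩ {non-split} (2 552 + 2 830 @3, 93 + 178 @5, 17 + 7 @7 classes, GVPAR-SUMMARY) the
residual inputs are now NAMED: {Hsieh 2014 Thm. 1 (PUB), `HsiehFrameResidualAt` (R₀-descent,
unprinted at `p ∣ N` reducible), H2, H3} + [ψ odd only] the partner's rank-zero MC; control and
Tamagawa links are theorems (p398508 / p398550). CONDITIONAL on every listed binder.

References: [Hsieh2014] Thm. 1 (arXiv:1112.1580 pp. 3–4); [Castella2018] Thm. 2.3, Thm. 3.2, §5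
(arXiv:1704.06608 pp. 5, 9, 12); [KellerYin2024] Thm. D; [CastellaEtAl2021] Thm. 5.3.1;
[Miller2011LMS] Def. 1.1.
-/

set_option autoImplicit false

noncomputable section

open scoped Classical MatrixGroups ModularForm

open CongruenceSubgroup WeierstrassCurve NumberField IsDedekindDomain Field PowerSeries
  Literature.NumberTheory.EllipticCurves Literature.NumberTheory.EllipticCurves.GreenbergSelmer
  Literature.NumberTheory.EllipticCurves.ModularForms
  Literature.NumberTheory.EllipticCurves.Rank1Residual
  Literature.NumberTheory.EllipticCurves.Rank1Residual.Typed
  Literature.NumberTheory.EllipticCurves.GreenbergVatsal2000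
  Literature.NumberTheory.EllipticCurves.Wuthrich2014
  Literature.NumberTheory.EllipticCurves.SteinWuthrich2013
  Literature.NumberTheory.GaloisRepresentations Literature.NumberTheory.GaloisCohomology
  Literature.NumberTheory.Automorphic
  Summit.BirchSwinnertonDyer.Rank1Residual.X11b.AcSelmer
  Summit.BirchSwinnertonDyer.Rank1Residual.X11b.Halves
  Summit.BirchSwinnertonDyer.Rank1Residual.X11b

namespace Summit.BirchSwinnertonDyer.Rank1Residual.X2

/-! ### The assembly: `CellCNonsplitNotGV` from print + residual + the two halves over the frame -/

section Assembly

variable (W : WeierstrassCurve ℚ) [W.IsElliptic] [W.IsGloballyMinimal] (p : ℕ) [Fact p.Prime]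

/-- **O9 sub-cell `CellCNonsplitNotGV` at a Heegner datum FROM PRINT + THE RESIDUAL + THE TWO HALVES
OVER THE FRAME.** `BSD(E,p)` from: the PUBLISHED facts of `X2/RankOneChain` (`hGV … hGS`), GZK /
modularity (`hGZK`, `hnf`, `hGZ`, `hKo`), the FIVE cited cohomological facts of the control theorem
(`hPT`, `hPT2`, `hEP`, `hcd`, `hBr`), Hsieh 2014 Thm. 1 (`hH`, PUB), the named residual `hres`
(`HsiehFrameResidualAt W p`, NOT in print), H2 (`NonsplitBDPValueOnTree W p`: PUB shape at `p ≥ 5`,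
open at `p = 3`) and H3 (`NonsplitIMCEqOnTree W p`: Keller–Yin Thm. D shape, PREPRINT with the
L1754 gap). The frame is PRODUCED: an embedding datum `ι₀ : ℚ̄_p ≃ ℂ` exists (Steinitz), the
degree-one `𝔭` of the datum is induced by `ι₀` or `ι₀ ∘ conj` (`X11b.exists_datum_forall_mem_iff`),
Hsieh + residual + glue give `(Ω_K, Ω_p, L)` there, H2/H3 are instantiated at it, and
`bsdp_of_cellCNonsplitNotGV_of_halves` concludes. Compared with p398550's
`bsdp_of_cellCNonsplitNotGV_of_imcWaldspurgerOnTree` the composite `IMCWaldspurgerOnTreeAt` is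
replaced by {Hsieh fact, residual, H2, H3}: every residual input of the ψ-even non-split O9 cell is
now NAMED. CONDITIONAL on every listed binder; nothing booked; no label change; X2 CONSTRUCTION-SHAPED.
[cite: Hsieh2014, Thm. 1 (arXiv:1112.1580 pp. 3–4)] [claim: KellerYin2024, status: under-review]
[cite: CastellaEtAl2021, Thm. 5.3.1] [cite: Castella2018, Thm. 2.3, Thm. 3.2 and §5 (arXiv:1704.06608 pp. 5, 9, 12)]
[cite: Miller2011LMS, Def. 1.1] -/
theorem bsdp_of_cellCNonsplitNotGV_of_hsieh2014_of_halvesOnTree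
    (hGV : lambdaMu_multiplicative_of_gvPar) (hWu : thm16_charIdeal_dvd_multiplicative_of_reducible)
    (hJs : thm61_splitMultiplicative) (hJn : thm61_nonsplitMultiplicative)
    (hHs : exists_isSplitMultCanonical) (hHn : exists_isMultCanonical)
    (hpar : nonempty_modularParametrizationData)
    (hGS : ∀ (W : WeierstrassCurve ℚ) [W.IsElliptic] [W.IsGloballyMinimal] (p : ℕ) [Fact p.Prime],
      greenberg_stevens (W := W) (p := p))
    (hnf : exists_isNewformOf)
    (hPT : ∀ (K : Type) [Field K] [NumberField K], poitouTate_selmerStructure_duality K)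
    (hPT2 : ∀ (K : Type) [Field K] [NumberField K], poitouTate_sha_tateDual K)
    (hEP : ∀ (K : Type) [Field K] [NumberField K] (v : HeightOneSpectrum (𝓞 K)),
      localEulerPoincareCharacteristic (v.adicCompletion K))
    (hcd : fieldCdLE_two_of_numberField)
    (hBr : ∀ (K : Type) [Field K] [NumberField K] (p : ℕ) [Fact p.Prime],
      ZpExtension.decomp_not_le_kerSubgroup_of_isAnticyclotomic K p)
    (hH : hsieh2014_exists_anticyclotomicPAdicLFunction)
    (N : ℕ) [NeZero N] (K : Type) [Field K] [NumberField K]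
    (Dt : ModularParametrizationData W N) (H : HeegnerDatum N (NumberField.discr K)) (ι : K →+* ℂ)
    (P : (W.baseChange K).toAffine.Point)
    (hGZ : gross_zagier N W K) (hKo : kolyvagin N W K)
    (hGZK : rank_eq_analyticRank_of_analyticRank_le_one)
    (hc : CellCNonsplitNotGV W p) (hN : W.conductorNorm ℤ = N) (hK : IsImaginaryQuadratic K)
    (hd4 : NumberField.discr K < -4) (hHN : SatisfiesHeegnerHypothesis N K)
    (hsplit : SatisfiesHeegnerHypothesis p K)
    (hP : WeierstrassCurve.Affine.Point.map ι.toRatAlgHom P = heegnerPointComplex Dt H)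
    (hPinf : ¬ IsOfFinAddOrder P) (hcM : ¬ (p : ℤ) ∣ Dt.c)
    (hLt : (W.quadraticTwist (NumberField.discr K : ℚ)).entireLFunction 1 ≠ 0)
    (Wd : WeierstrassCurve ℚ) [Wd.IsElliptic] [Wd.IsGloballyMinimal] (Cd : VariableChange ℚ)
    (hWd : Cd • W.quadraticTwist (NumberField.discr K : ℚ) = Wd)
    (htam : padicValNat p Wd.tamagawaProduct = padicValNat p W.tamagawaProduct)
    (hu : padicValRat p (Cd.u : ℚ) = 0)
    (htamK : padicValNat p (W.baseChange K).tamagawaProduct = 2 * padicValNat p W.tamagawaProduct)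
    (κ : ZpExtension K p) (hκ : κ.IsAnticyclotomic) (γ : Field.absoluteGaloisGroup K)
    [Fact (κ.IsTopGenerator γ)] (𝔭 : HeightOneSpectrum (𝓞 K))
    (h𝔭 : ((p : ℕ) : 𝓞 K) ∈ 𝔭.asIdeal) (he : 𝔭.asIdeal.ramificationIdx (𝓞 ℚ) = 1)
    (hf : 𝔭.asIdeal.inertiaDeg (𝓞 ℚ) = 1)
    (hres : HsiehFrameResidualAt W p) (h2 : NonsplitBDPValueOnTree W p)
    (h3 : NonsplitIMCEqOnTree W p) : BSDp W p := by
  subst hN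
  obtain ⟨f, hfW⟩ := hnf W
  obtain ⟨ι₀⟩ := PadicAlgCl.nonempty_ringEquiv_complex p
  obtain ⟨ι', -, hι'⟩ := X11b.exists_datum_forall_mem_iff p ι₀ hK h𝔭
  obtain ⟨ΩK, Ωp, L, hΩK, hL⟩ := exists_isBDPLFunction_of_hsieh2014_of_not_split W p hH hres ι' 𝔭 κ
    γ hfW hc.1.2 hc.2.1 rfl hK hHN h𝔭 he hf hι' hκ Fact.out
  exact bsdp_of_cellCNonsplitNotGV_of_halves W p hGV hWu hJs hJn hHs hHn hpar hGS hnf hPT hPT2 hEP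
    hcd hBr (W.conductorNorm ℤ) K Dt H ι P hGZ hKo hGZK hc rfl hK hd4 hHN hsplit hP hPinf hcM hLt Wd
    Cd hWd htam hu htamK κ hκ γ 𝔭 h𝔭 he hf L
    (h3 (W.conductorNorm ℤ) K Dt H ι P hc.1 hc.2.1 rfl hK hd4 hHN hLt hP hcM hPinf κ hκ γ 𝔭 h𝔭 he
      hf f hfW ι' hι' ΩK Ωp L hΩK hL)
    (h2 (W.conductorNorm ℤ) K Dt H ι P hc.1 hc.2.1 rfl hK hd4 hHN hLt hP hcM hPinf κ hκ γ 𝔭 h𝔭 he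
      hf f hfW ι' hι' ΩK Ωp L hΩK hL)

/-- **Either parity: O9 ∩ {non-split} at a Heegner datum FROM PRINT + THE RESIDUAL + THE TWO HALVES
OVER THE FRAME + the partner's rank-zero `p`-part.** p398550's
`bsdp_of_cellC_of_not_split_of_imcWaldspurgerOnTree_of_partner` with the composite input
`IMCWaldspurgerOnTreeAt` REPLACED by {Hsieh 2014 Thm. 1 (`hH`), `HsiehFrameResidualAt W p` (`hres`),
H2 `NonsplitBDPValueOnTree W p`, H3 `NonsplitIMCEqOnTree W p`}: for a rank-one X2 pair at a
NON-split `p` of EITHER parity, `BSD(E,p)` given additionally the partner's `PPartRankZero Wd p`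
(`Wd` = the CGLS twist `E^{d_K}`, rank `0`, non-split X2b — CLOSED in X2a when ψ is even; OPEN
class-wide when ψ is odd: Mazur's main conjecture at a non-split Eisenstein `p ‖ N`, the target of
MEMO-1's K2ᴱ-cyc / MEMO-2's R9 via p396260 / p396524). So ALL of O9 ∩ {non-split}
(2 552 + 2 830 @3, 93 + 178 @5, 17 + 7 @7 classes) now reads: {Hsieh fact, residual, H2, H3} +
[ψ odd only] the partner's rank-zero MC. CONDITIONAL on every listed binder; nothing booked.
[cite: Hsieh2014, Thm. 1 (arXiv:1112.1580 pp. 3–4)] [claim: KellerYin2024, status: under-review]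
[cite: Castella2018, Thm. 2.3, Thm. 3.2 and §5 (arXiv:1704.06608 pp. 5, 9, 12)] [cite: Miller2011LMS, Def. 1.1] -/
theorem bsdp_of_cellC_of_not_split_of_hsieh2014_of_halvesOnTree_of_partner
    (hnf : exists_isNewformOf)
    (hPT : ∀ (K : Type) [Field K] [NumberField K], poitouTate_selmerStructure_duality K)
    (hPT2 : ∀ (K : Type) [Field K] [NumberField K], poitouTate_sha_tateDual K)
    (hEP : ∀ (K : Type) [Field K] [NumberField K] (v : HeightOneSpectrum (𝓞 K)),
      localEulerPoincareCharacteristic (v.adicCompletion K))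
    (hcd : fieldCdLE_two_of_numberField)
    (hBr : ∀ (K : Type) [Field K] [NumberField K] (p : ℕ) [Fact p.Prime],
      ZpExtension.decomp_not_le_kerSubgroup_of_isAnticyclotomic K p)
    (hH : hsieh2014_exists_anticyclotomicPAdicLFunction)
    (N : ℕ) [NeZero N] (K : Type) [Field K] [NumberField K]
    (Dt : ModularParametrizationData W N) (H : HeegnerDatum N (NumberField.discr K)) (ι : K →+* ℂ)
    (P : (W.baseChange K).toAffine.Point)
    (hGZ : gross_zagier N W K) (hKo : kolyvagin N W K)
    (hGZK : rank_eq_analyticRank_of_analyticRank_le_one)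
    (hc : CellC W p) (hns : ¬ W.HasSplitMultiplicativeReductionAtPrime p) (hN : W.conductorNorm ℤ = N)
    (hK : IsImaginaryQuadratic K) (hd4 : NumberField.discr K < -4)
    (hHN : SatisfiesHeegnerHypothesis N K) (hsplit : SatisfiesHeegnerHypothesis p K)
    (hP : WeierstrassCurve.Affine.Point.map ι.toRatAlgHom P = heegnerPointComplex Dt H)
    (hPinf : ¬ IsOfFinAddOrder P) (hcM : ¬ (p : ℤ) ∣ Dt.c)
    (hLt : (W.quadraticTwist (NumberField.discr K : ℚ)).entireLFunction 1 ≠ 0)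
    (Wd : WeierstrassCurve ℚ) [Wd.IsElliptic] [Wd.IsGloballyMinimal] (Cd : VariableChange ℚ)
    (hWd : Cd • W.quadraticTwist (NumberField.discr K : ℚ) = Wd) (htw : PPartRankZero Wd p)
    (htam : padicValNat p Wd.tamagawaProduct = padicValNat p W.tamagawaProduct)
    (hu : padicValRat p (Cd.u : ℚ) = 0)
    (htamK : padicValNat p (W.baseChange K).tamagawaProduct = 2 * padicValNat p W.tamagawaProduct)
    (κ : ZpExtension K p) (hκ : κ.IsAnticyclotomic) (γ : Field.absoluteGaloisGroup K)
    [Fact (κ.IsTopGenerator γ)] (𝔭 : HeightOneSpectrum (𝓞 K))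
    (h𝔭 : ((p : ℕ) : 𝓞 K) ∈ 𝔭.asIdeal) (he : 𝔭.asIdeal.ramificationIdx (𝓞 ℚ) = 1)
    (hf : 𝔭.asIdeal.inertiaDeg (𝓞 ℚ) = 1)
    (hres : HsiehFrameResidualAt W p) (h2 : NonsplitBDPValueOnTree W p)
    (h3 : NonsplitIMCEqOnTree W p) : BSDp W p := by
  subst hN
  obtain ⟨f, hfW⟩ := hnf W
  obtain ⟨ι₀⟩ := PadicAlgCl.nonempty_ringEquiv_complex p
  obtain ⟨ι', -, hι'⟩ := X11b.exists_datum_forall_mem_iff p ι₀ hK h𝔭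
  obtain ⟨ΩK, Ωp, L, hΩK, hL⟩ := exists_isBDPLFunction_of_hsieh2014_of_not_split W p hH hres ι' 𝔭 κ
    γ hfW hc.2 hns rfl hK hHN h𝔭 he hf hι' hκ Fact.out
  exact bsdp_of_cellC_of_not_split_of_imcWaldspurgerOnTree_of_partner hnf hPT hPT2 hEP hcd hBr W p
    (W.conductorNorm ℤ) K Dt H ι P hGZ hKo hGZK hc hns rfl hK hd4 hHN hsplit hP hPinf hcM hLt Wd Cd
    hWd htw htam hu htamK κ hκ γ 𝔭 h𝔭 he hf
    (imcWaldspurgerOnTreeAt_of_halves_of_not_split_of_rankOne W p hGZK hnf hPT hPT2 hEP hcd hBr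
      hc.2.1 hc.2.2.2 hns hc.1 hK (hsplit p Fact.out dvd_rfl) hLt P hPinf κ hκ γ 𝔭 h𝔭 he hf L
      (h3 (W.conductorNorm ℤ) K Dt H ι P hc hns rfl hK hd4 hHN hLt hP hcM hPinf κ hκ γ 𝔭 h𝔭 he
        hf f hfW ι' hι' ΩK Ωp L hΩK hL)
      (h2 (W.conductorNorm ℤ) K Dt H ι P hc hns rfl hK hd4 hHN hLt hP hcM hPinf κ hκ γ 𝔭 h𝔭 he
        hf f hfW ι' hι' ΩK Ωp L hΩK hL))

/-- **Either parity, with the partner's input in MAIN-CONJECTURE form**: as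
`bsdp_of_cellC_of_not_split_of_hsieh2014_of_halvesOnTree_of_partner`, but the partner's rank-zero
`p`-part `PPartRankZero Wd p` is DERIVED from **`X2.MazurMainConjectureAt Wd p`** — Mazur's main
conjecture at the NON-split Eisenstein prime `p ‖ N` for the CGLS twist `E^{d_K}` (rank `0`, again X2
and non-split at `p`: `classX2_twist`) — through the published rank-zero closer
`bsdp_of_mazurMainConjectureAt_of_analyticRank_eq_zero` (`X2/RankZero.lean`: Stein–Wuthrich 6.1,
canonical heights, GZK, modularity, Greenberg–Stevens) and `pPart_of_bsdp` / `pPartRankZero_of_pPart`.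
So ALL of O9 ∩ {non-split} reads: {Hsieh 2014 Thm. 1, `HsiehFrameResidualAt W p`, H2, H3} at `E` +
`MazurMainConjectureAt` at the partner (needed only when ψ is odd; when ψ is even it is
Greenberg–Vatsal's, `pPartRankZero_twist_of_not_gvPar`) — the latter is the target of MEMO-4 §B
(R9: CGS §§1–3, 6 at the p-new point, modulo Keller–Yin Thm. D). CONDITIONAL on every listed
binder; nothing booked; no label change. [cite: CastellaEtAl2021, Thm. 5.3.1 and its proof]
[cite: SteinWuthrich2013, Thm. 6.1] [claim: KellerYin2024, status: under-review] [cite: Miller2011LMS, Def. 1.1] -/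
theorem bsdp_of_cellC_of_not_split_of_hsieh2014_of_halvesOnTree_of_mazurMainConjectureAt
    (hJs : thm61_splitMultiplicative) (hJn : thm61_nonsplitMultiplicative)
    (hHs : exists_isSplitMultCanonical) (hHn : exists_isMultCanonical)
    (hpar : nonempty_modularParametrizationData)
    (hGS : ∀ (W : WeierstrassCurve ℚ) [W.IsElliptic] [W.IsGloballyMinimal] (p : ℕ) [Fact p.Prime],
      greenberg_stevens (W := W) (p := p))
    (hnf : exists_isNewformOf)
    (hPT : ∀ (K : Type) [Field K] [NumberField K], poitouTate_selmerStructure_duality K)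
    (hPT2 : ∀ (K : Type) [Field K] [NumberField K], poitouTate_sha_tateDual K)
    (hEP : ∀ (K : Type) [Field K] [NumberField K] (v : HeightOneSpectrum (𝓞 K)),
      localEulerPoincareCharacteristic (v.adicCompletion K))
    (hcd : fieldCdLE_two_of_numberField)
    (hBr : ∀ (K : Type) [Field K] [NumberField K] (p : ℕ) [Fact p.Prime],
      ZpExtension.decomp_not_le_kerSubgroup_of_isAnticyclotomic K p)
    (hH : hsieh2014_exists_anticyclotomicPAdicLFunction)
    (N : ℕ) [NeZero N] (K : Type) [Field K] [NumberField K]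
    (Dt : ModularParametrizationData W N) (H : HeegnerDatum N (NumberField.discr K)) (ι : K →+* ℂ)
    (P : (W.baseChange K).toAffine.Point)
    (hGZ : gross_zagier N W K) (hKo : kolyvagin N W K)
    (hGZK : rank_eq_analyticRank_of_analyticRank_le_one)
    (hc : CellC W p) (hns : ¬ W.HasSplitMultiplicativeReductionAtPrime p) (hN : W.conductorNorm ℤ = N)
    (hK : IsImaginaryQuadratic K) (hd4 : NumberField.discr K < -4)
    (hHN : SatisfiesHeegnerHypothesis N K) (hsplit : SatisfiesHeegnerHypothesis p K)
    (hP : WeierstrassCurve.Affine.Point.map ι.toRatAlgHom P = heegnerPointComplex Dt H)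
    (hPinf : ¬ IsOfFinAddOrder P) (hcM : ¬ (p : ℤ) ∣ Dt.c)
    (hLt : (W.quadraticTwist (NumberField.discr K : ℚ)).entireLFunction 1 ≠ 0)
    (Wd : WeierstrassCurve ℚ) [Wd.IsElliptic] [Wd.IsGloballyMinimal] (Cd : VariableChange ℚ)
    (hWd : Cd • W.quadraticTwist (NumberField.discr K : ℚ) = Wd)
    (hMC : MazurMainConjectureAt Wd p)
    (htam : padicValNat p Wd.tamagawaProduct = padicValNat p W.tamagawaProduct)
    (hu : padicValRat p (Cd.u : ℚ) = 0)
    (htamK : padicValNat p (W.baseChange K).tamagawaProduct = 2 * padicValNat p W.tamagawaProduct)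
    (κ : ZpExtension K p) (hκ : κ.IsAnticyclotomic) (γ : Field.absoluteGaloisGroup K)
    [Fact (κ.IsTopGenerator γ)] (𝔭 : HeightOneSpectrum (𝓞 K))
    (h𝔭 : ((p : ℕ) : 𝓞 K) ∈ 𝔭.asIdeal) (he : 𝔭.asIdeal.ramificationIdx (𝓞 ℚ) = 1)
    (hf : 𝔭.asIdeal.inertiaDeg (𝓞 ℚ) = 1)
    (hres : HsiehFrameResidualAt W p) (h2 : NonsplitBDPValueOnTree W p)
    (h3 : NonsplitIMCEqOnTree W p) : BSDp W p := by
  have hmod : hasEntireLFunction_rat := hasEntireLFunction_rat_of_exists_isNewformOf hnf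
  -- the partner `Wd` is a rank-zero X2 pair (non-split at `p`, though only X2-ness is used here)
  have hC : Cd⁻¹ • Wd = W.quadraticTwist (NumberField.discr K : ℚ) := by
    rw [← hWd, inv_smul_smul]
  have hXd : ClassX2 Wd p := classX2_twist W p hc.2 K hK hsplit Wd ⟨Cd⁻¹, hC⟩
  have hLd : Wd.entireLFunction 1 ≠ 0 := by
    rw [← Wd.entireLFunction_smul Cd⁻¹, hC]
    exact hLt
  have hrd : Wd.analyticRank = 0 := analyticRank_eq_zero_of_entireLFunction_one_ne_zero hLd
  have htw : PPartRankZero Wd p :=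
    pPartRankZero_of_pPart hGZK Wd p hrd
      (pPart_of_bsdp hmod hGZK Wd p (by omega)
        (bsdp_of_mazurMainConjectureAt_of_analyticRank_eq_zero hJs hJn hHs hHn hGZK hmod hpar Wd p
          (hGS Wd p) hXd.1 hXd.2.2 hrd hMC))
  exact bsdp_of_cellC_of_not_split_of_hsieh2014_of_halvesOnTree_of_partner W p hnf hPT hPT2 hEP hcd
    hBr hH N K Dt H ι P hGZ hKo hGZK hc hns hN hK hd4 hHN hsplit hP hPinf hcM hLt Wd Cd hWd htw htam hu
    htamK κ hκ γ 𝔭 h𝔭 he hf hres h2 h3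

end Assembly

end Summit.BirchSwinnertonDyer.Rank1Residual.X2

end
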